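import Literature.AlgebraicGeometry.Surfaces.K3TranscendentalHodgeSimilitudesKugaSatake
import Literature.AlgebraicGeometry.Surfaces.K3NikulinInvolution
import HarnessLib

/-!
# Real multiplication by `√p` on a K3 surface with a symplectic automorphism of prime order `p` is algebraic (Varesco, Math. Z. 305 (2023), §2 Thm. 2.1) — NAMED FACT

Layer `Literature/AlgebraicGeometry/Surfaces`.  CITE record for the cross-ladder literature-typing layer
(D-0088(4), tranche LT-H4 "open-question harvest", seat `hodge-lit-oqh-2`, generation 4): Varesco's §2
("Symplectic automorphisms and algebraic Hodge similarities"), left in the "Not here" of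
`K3TranscendentalHodgeSimilitudesKugaSatake` (Thm. 5.3) and of
`Hyperkaehler/TranscendentalHodgeSimilitudesKugaSatake` (Thm. 4.5 / Cor. 4.6 / Thm. 5.1).  Consumer BY
NAME: route `HodgeConjecture/NikulinTwinTransport`, whose thesis cites "Varesco2023 Thm 2.1 / Prop 2.5"
six times as THE KNOWN ON-LOCUS CASE of its cruxes ("`√p` algebraic only ON the Nikulin / `σ_p` locus",
"known only on the Nikulin locus (Varesco2023 Thm 2.1, Prop 2.5)"): the `p = 2` spelling
`….of_isNikulinInvolution` below is that sentence as a Lean statement on the route's own carriers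
(`IsK3Surface`, `IsNikulinInvolution`, `transcendentalSubspace`, cup product on `H²(S(ℂ); ℂ)`).

HONEST FRAMING: typed ≠ proved ≠ endorsed.  An UNCONDITIONAL theorem printed and proved in a refereed
journal, recorded as a named fact (D-0014, statement only) in the REDUCED form its proof establishes
directly; nothing here asserts HC for any surface, nothing asserts HC ∕ HC_AV ∕ W₆ ∕ HC_Kum4Type.

## Source (read at source this session; locators = files of the materialised arXiv text `paper:arxiv-2304.02519`)

* [Var23] M. Varesco, *Hodge similarities, algebraic classes, and Kuga–Satake varieties*, Math. Z. 305
  (2023), art. 69 = arXiv:2304.02519 [`Varesco2023`; REFEREED].  §2 [p0008:L3]: "Let `X` be a K3 surface,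
  and denote by `q` the polarization on `T(X)` given by the negative of the intersection form."
  [p0008:L10]: "proving the Hodge conjecture for `X²` is equivalent to showing that every element of
  `End_Hdg(T(X))` is algebraic."  THE STARTING OBSERVATION [p0008:L12–L28]: "given a K3 surface `X` with
  a symplectic automorphism of order `p`, there exists a K3 surface `Y` and an algebraic Hodge similarity
  `φ : T(Y) → T(X)` of multiplier `p`. To show this, recall that, by [Huybrechts, Lectures on K3
  surfaces], the prime `p` is at most `7`, the fixed locus of `σ_p` is a finite union of points, and the
  minimal resolution of `X/σ_p` is a K3 surface `Y` […] `φ ≔ β_* π^* : T(Y) → T(X)` is a Hodge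
  similarity of multiplier `p`. Note that `φ` is algebraic."  **Theorem 2.1** [p0008:L30–L33, verbatim]:
  "Let `X` be a K3 surface Hodge isometric to a K3 surface with a symplectic automorphism of prime order
  `p`. Assume furthermore that `ℚ(√p) ⊆ End_Hdg(T(X))`. Then, the Hodge similarity `√p` is algebraic."
  PROOF [p0008:L35–L37, verbatim]: "As Hodge isometries of K3 surfaces are algebraic by [Buskin 2019]
  and [Huybrechts 2019], we may assume that `X` admits a symplectic automorphism of order `p`. Let `ψ` be
  the Hodge similarity of multiplier `p` on `T(X)`, which exists since `ℚ(√p) ⊆ End_Hdg(T(X))` by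
  assumption. […] The composition `φ⁻¹ ∘ ψ : T(X) → T(Y)` is then a Hodge isometry. In particular,
  `φ⁻¹ ∘ ψ` is algebraic […]. As `φ` is algebraic, we conclude that `ψ = φ ∘ (φ⁻¹ ∘ ψ)` is algebraic."
  **Remark 2.2** [p0008:L41–L43]: "the general K3 surface with a symplectic automorphism of order `p` has
  endomorphism field equal to `ℚ`. […] the requirement 'the endomorphisms field of `X` contains `ℚ(√p)`'
  is equivalent to the condition '`X` admits a Hodge similarity `ψ` of multiplier `d` which is fixed by
  the Rosati involution' […] `ψ²/d` is the identity".  Intro [p0004:L1]: "The condition '`X` is Hodge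
  isometric to a K3 surface with a symplectic automorphism of order `p`' is equivalent to `T(X) ↪ U³_ℚ ⊕
  E₈(−2)_ℚ` for `p = 2` and to `T(X) ↪ U³_ℚ ⊕ (A₂)²_ℚ` for `p = 3`" (= **Prop. 2.5** [p0009:L28–L31]: "A
  K3 surface `X` is Hodge isometric to a K3 surface admitting a Nikulin involution if and only if `T(X)
  ⊆ U³_ℚ ⊕ E₈(−2)_ℚ`", and Prop. 2.11).  **Theorem 2.9** [p0010:L40–L45]: "For every K3 surface in the
  four-dimensional families of K3 surfaces with endomorphism field containing `ℚ(√2)` which are Hodge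
  isometric to a K3 surface with a Nikulin involution, the endomorphism `√2` is algebraic. In particular,
  the Hodge conjecture holds for the square of the general such K3 surface."  **Remark 2.16**
  [p0011:L51–L52]: "In the case of symplectic automorphisms of order bigger than `3`, the same procedure
  does not produce any K3 surface […] the endomorphism [field] of a K3 surface with a symplectic
  automorphism of order `5` or `7` is always `ℚ` or a CM field".
* Symplectic automorphisms: Huybrechts, *Lectures on K3 Surfaces*, Ch. 15 Def. 1.1 (the tree's
  `Surfaces.IsSymplectic`, file `K3NikulinInvolution`); van Geemen–Sarti, Math. Z. 255 (2007) §1.1 (the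
  tree's `Surfaces.IsNikulinInvolution`).

## Rendering (tree carriers) and faithfulness

* "K3 surface" ([Var23] §1: projective): `Surfaces.IsK3Surface S`.
* "symplectic automorphism of prime order `p`": an endomorphism `σ : S ⟶ S` with `σᵖ = 𝟙` in the monoid
  `CategoryTheory.End S` (so `σ` is an automorphism), `σ ≠ 𝟙`, `p` prime, and `IsSymplectic S σ` (`σ^*`
  fixes the `(2,0)`-classes) — `IsSymplecticOfPrimeOrder S σ p` below; for `p = 2` this IS the tree's
  `IsNikulinInvolution S σ` (PROVED `isNikulinInvolution_iff_isSymplecticOfPrimeOrder_two`).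
* "`T(X)`": the cup-orthogonal complement `Surfaces.transcendentalSubspace S` of the Néron–Severi group
  (tensored with `ℂ`), the carrier of the tree's K3 records and of Thm. 5.3's `….of_transcendentalSubspace`.
* "`ψ = √p ∈ End_Hdg(T(X))`, the Hodge similarity of multiplier `p`": a `ℂ`-linear `ψ` on `H²(S(ℂ); ℂ)`
  that maps `T(S)` into itself, preserves rationality and Hodge types there, satisfies `ψ(ψ x) = p·x` on
  `T(S)`, and is a similitude of multiplier `p` for the cup product on `T(S)`: `(ψx · ψy) = p·(x · y)`
  (same surface, same `H⁴`: no orientation/generator convention is needed).  Self-adjointness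
  ("fixed by the Rosati involution", Rem. 2.2) then FOLLOWS — PROVED below
  (`cupProduct_selfAdjoint_of_sq_of_multiplier`), so it is not assumed.
* "is algebraic": as in the Thm. 5.3 record — some `T` induced by an algebraic cycle on `S × S`
  (`HodgeTheory.IsAlgebraicCorrespondence 2 2 S S T`, `ℂ`-span convention) agrees with `ψ` on `T(S)`.
* REDUCED FORM.  The record assumes that `X` ITSELF carries `σ_p` — the case to which the printed proof
  reduces in its first sentence via Buskin–Huybrechts (`Surfaces.Buskin2019_hodgeIsometry_algebraic`, in
  the tree).  The printed hypothesis "Hodge isometric to such a surface" is WEAKER, so the record is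
  weaker-or-equal than print (never stronger).  The general form is the reduced form composed with
  Buskin's theorem along a rational Hodge isometry `T(S₀)_ℚ ⥲ T(S)_ℚ` (extended to `H²` by Witt
  cancellation) — a composition left to the consumer; not restated here to avoid a cross-surface
  orientation convention on `H⁴`.

## Content and D-0026 accounting

One definition with body (`IsSymplecticOfPrimeOrder`, + the `p = 2` dictionary lemma), ONE named fact
(+1; absent before: `lean search 'symplectic automorphism|SymplecticOfPrimeOrder|sqrt.*algebraic|Varesco2023'`
finds `IsSymplectic`, `IsNikulinInvolution`, the Thm. 4.5/4.6/5.1/5.3 records and no §2 statement):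
`Varesco2023_sqrtMultiplication_algebraic_of_symplecticAutomorphism`.  Kernel (PROVED): self-adjointness
from (`ψ² = p`, multiplier `p`); the Nikulin-involution spelling `….of_isNikulinInvolution` (the route's
"on-locus known case", `p = 2`).  NOT here: the starting observation `φ = β_*π^* : T(Y) → T(X)` as a
separate record (needs the quotient `X/σ_p` and its minimal resolution, absent carriers, or a
cross-surface multiplier convention); Prop. 2.3 / Prop. 2.5 / Prop. 2.11 (period-domain loci and the
lattice criteria `T(X) ↪ U³_ℚ ⊕ E₈(−2)_ℚ`, `U³_ℚ ⊕ (A₂)²_ℚ`); Thm. 2.9 / Thm. 2.15 (the four- and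
two-dimensional families) and "HC for `X²` of the general member"; Rem. 2.16 (`p = 5, 7` give nothing);
any proof of the record.
-/

noncomputable section

open CategoryTheory _root_.AlgebraicGeometry
open Literature.AlgebraicTopology.SingularHomology

namespace Literature.AlgebraicGeometry.Surfaces

open HodgeTheory

variable (S : Motives.SchemeOver ℂ)

/-! ### Symplectic automorphisms of prime order -/

/-- **Symplectic automorphism of prime order `p`** of (a K3 surface) `S` (Varesco §2: "a symplectic
automorphism of prime order `p`"; Huybrechts Ch. 15 Def. 1.1 for "symplectic"): an endomorphism `σ`
with `σᵖ = 𝟙` in `End S` (hence an automorphism), `σ ≠ 𝟙`, `p` prime — so `σ` has order exactly `p` —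
and `σ^*` fixes the `(2,0)`-classes (`IsSymplectic`). [cite: Varesco2023, §2 (p0008:L12) and Thm. 2.1]
[cite: Huybrechts2016K3, Ch. 15 Def. 1.1] -/
def IsSymplecticOfPrimeOrder (σ : S ⟶ S) (p : ℕ) : Prop :=
  p.Prime ∧ CategoryTheory.End.of σ ^ p = 1 ∧ σ ≠ 𝟙 S ∧ IsSymplectic S σ

variable {S}

/-- Unfolding. [cite: Varesco2023, §2 Thm. 2.1] -/
theorem isSymplecticOfPrimeOrder_iff {σ : S ⟶ S} {p : ℕ} :
    IsSymplecticOfPrimeOrder S σ p ↔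
      p.Prime ∧ CategoryTheory.End.of σ ^ p = 1 ∧ σ ≠ 𝟙 S ∧ IsSymplectic S σ :=
  Iff.rfl

/-- `σ² = 𝟙` in `End S` is `σ ≫ σ = 𝟙`. [cite: VanGeemenSarti2007, §1.1] -/
theorem end_of_sq_eq_one_iff (σ : S ⟶ S) :
    CategoryTheory.End.of σ ^ 2 = 1 ↔ σ ≫ σ = 𝟙 S := by
  rw [pow_two]
  rfl

/-- **Dictionary, `p = 2`**: a Nikulin involution (van Geemen–Sarti §1.1: "an automorphism of order two
such that `ι^*ω = ω` for all `ω ∈ H^{2,0}(X)`") is exactly a symplectic automorphism of prime order `2`.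
[cite: VanGeemenSarti2007, §1.1] [cite: Varesco2023, §2 (Nikulin involutions = `p = 2`)] -/
theorem isNikulinInvolution_iff_isSymplecticOfPrimeOrder_two {ι : S ⟶ S} :
    IsNikulinInvolution S ι ↔ IsSymplecticOfPrimeOrder S ι 2 := by
  rw [isSymplecticOfPrimeOrder_iff, end_of_sq_eq_one_iff]
  exact ⟨fun h ↦ ⟨Nat.prime_two, h.1, h.2.1, h.2.2⟩, fun h ↦ ⟨h.2.1, h.2.2.1, h.2.2.2⟩⟩

/-- A symplectic automorphism of prime order is symplectic. [cite: Varesco2023, §2] -/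
theorem IsSymplecticOfPrimeOrder.isSymplectic {σ : S ⟶ S} {p : ℕ}
    (h : IsSymplecticOfPrimeOrder S σ p) : IsSymplectic S σ :=
  h.2.2.2

/-- … and its order `p` is a prime (`≤ 7` by Nikulin — not recorded). [cite: Varesco2023, §2 (p0008:L12)] -/
theorem IsSymplecticOfPrimeOrder.prime {σ : S ⟶ S} {p : ℕ} (h : IsSymplecticOfPrimeOrder S σ p) :
    p.Prime :=
  h.1

/-! ### Rem. 2.2, the automatic half: a similitude `ψ` of multiplier `p` with `ψ² = p` is self-adjoint -/

/-- **Self-adjointness is automatic** (the direction of Rem. 2.2 used implicitly in Thm. 2.1: "`ψ²/d` is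
the identity" ⟹ `ψ` fixed by the Rosati involution): on a subspace `W` stable under `ψ`, if
`ψ(ψ y) = c·y` and `(ψx · ψy) = c·(x · y)` on `W` with `c ≠ 0`, then `(ψx · y) = (x · ψy)` on `W`.
Pure bilinear algebra: `c·(ψx · y) = (ψx · ψ(ψy)) = c·(x · ψy)`. [cite: Varesco2023, Rem. 2.2 (p0008:L41–L43)] -/
theorem cupProduct_selfAdjoint_of_sq_of_multiplier (W : Submodule ℂ (complexBetti S (2 * 1)))
    (ψ : complexBetti S (2 * 1) →ₗ[ℂ] complexBetti S (2 * 1)) {c : ℂ} (hc : c ≠ 0)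
    (hW : Set.MapsTo ψ W W) (hsq : ∀ y ∈ W, ψ (ψ y) = c • y)
    (hmul : ∀ x ∈ W, ∀ y ∈ W,
      cupProduct (rfl : 2 * 1 + 2 * 1 = 2 * 2) (ψ x) (ψ y) = c • cupProduct (rfl : 2 * 1 + 2 * 1 = 2 * 2) x y) :
    ∀ x ∈ W, ∀ y ∈ W,
      cupProduct (rfl : 2 * 1 + 2 * 1 = 2 * 2) (ψ x) y = cupProduct (rfl : 2 * 1 + 2 * 1 = 2 * 2) x (ψ y) := by
  intro x hx y hy
  have h := hmul x hx (ψ y) (hW hy)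
  rw [hsq y hy, map_smul] at h
  exact smul_right_injective _ hc h

/-! ### Varesco 2023 Thm. 2.1 — the named fact (reduced form) -/

/-- **Varesco 2023, Theorem 2.1 (reduced form of its proof) — on a projective K3 surface carrying a
symplectic automorphism of prime order `p`, a Hodge similitude `ψ = √p` of `T(S)` (multiplier `p`,
`ψ² = p`) is induced by an algebraic cycle on `S × S`.**  Print (verbatim in the module docstring): "Let
`X` be a K3 surface Hodge isometric to a K3 surface with a symplectic automorphism of prime order `p`.
Assume furthermore that `ℚ(√p) ⊆ End_Hdg(T(X))`. Then, the Hodge similarity `√p` is algebraic", whose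
proof begins "we may assume that `X` admits a symplectic automorphism of order `p`" (Buskin–Huybrechts).
Rendering: for `S` a K3 surface with `IsSymplecticOfPrimeOrder S σ p` and `ψ : H²(S(ℂ); ℂ) → H²(S(ℂ);
ℂ)` mapping `transcendentalSubspace S` into itself, rational and type-preserving there, with
`ψ(ψ x) = p·x` and `(ψx · ψy) = p·(x · y)` on it, some `T` induced by an algebraic cycle on `S × S`
agrees with `ψ` on `transcendentalSubspace S`.  WEAKER than print only in assuming `σ_p` on `S` itself
(print: on a surface Hodge isometric to `S`; general form = this ∘ `Buskin2019_hodgeIsometry_algebraic`).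
A THEOREM in print (REFEREED: Math. Z. 2023; unconditional; unproved in the tree).
[cite: Varesco2023, Thm. 2.1 with its proof (§2, p0008:L12–L37) and Rem. 2.2] -/
def Varesco2023_sqrtMultiplication_algebraic_of_symplecticAutomorphism : Prop :=
  ∀ ⦃S : Motives.SchemeOver ℂ⦄ (_hS : IsK3Surface S) (σ : S ⟶ S) (p : ℕ),
    IsSymplecticOfPrimeOrder S σ p →
  ∀ (ψ : complexBetti S (2 * 1) →ₗ[ℂ] complexBetti S (2 * 1)),
    Set.MapsTo ψ (transcendentalSubspace S) (transcendentalSubspace S) →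
    (∀ x ∈ transcendentalSubspace S, IsRationalClass x → IsRationalClass (ψ x)) →
    (∀ (i j : ℕ), ∀ x ∈ transcendentalSubspace S,
      IsOfHodgeType 2 S (2 * 1) i j x → IsOfHodgeType 2 S (2 * 1) i j (ψ x)) →
    (∀ x ∈ transcendentalSubspace S, ψ (ψ x) = (p : ℂ) • x) →
    (∀ x ∈ transcendentalSubspace S, ∀ y ∈ transcendentalSubspace S,
      cupProduct (rfl : 2 * 1 + 2 * 1 = 2 * 2) (ψ x) (ψ y) =
        (p : ℂ) • cupProduct (rfl : 2 * 1 + 2 * 1 = 2 * 2) x y) →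
  ∃ T : complexBetti S (2 * 1) →ₗ[ℂ] complexBetti S (2 * 1),
    IsAlgebraicCorrespondence 2 2 S S T ∧ ∀ x ∈ transcendentalSubspace S, T x = ψ x

namespace Varesco2023_sqrtMultiplication_algebraic_of_symplecticAutomorphism

/-- **The hypotheses of the record make `ψ` self-adjoint on `T(S)`** (so the "fixed by the Rosati
involution" clause of Rem. 2.2 need not be assumed): kernel, from
`cupProduct_selfAdjoint_of_sq_of_multiplier` with `c = p ≠ 0`. [cite: Varesco2023, Rem. 2.2] -/
theorem selfAdjoint {S : Motives.SchemeOver ℂ} {σ : S ⟶ S} {p : ℕ} (hσ : IsSymplecticOfPrimeOrder S σ p)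
    (ψ : complexBetti S (2 * 1) →ₗ[ℂ] complexBetti S (2 * 1))
    (hT : Set.MapsTo ψ (transcendentalSubspace S) (transcendentalSubspace S))
    (hsq : ∀ x ∈ transcendentalSubspace S, ψ (ψ x) = (p : ℂ) • x)
    (hmul : ∀ x ∈ transcendentalSubspace S, ∀ y ∈ transcendentalSubspace S,
      cupProduct (rfl : 2 * 1 + 2 * 1 = 2 * 2) (ψ x) (ψ y) =
        (p : ℂ) • cupProduct (rfl : 2 * 1 + 2 * 1 = 2 * 2) x y) :
    ∀ x ∈ transcendentalSubspace S, ∀ y ∈ transcendentalSubspace S,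
      cupProduct (rfl : 2 * 1 + 2 * 1 = 2 * 2) (ψ x) y =
        cupProduct (rfl : 2 * 1 + 2 * 1 = 2 * 2) x (ψ y) :=
  cupProduct_selfAdjoint_of_sq_of_multiplier (transcendentalSubspace S) ψ
    (Nat.cast_ne_zero.2 hσ.prime.ne_zero) hT hsq hmul

/-- **The route's "on-locus known case", `p = 2` (Varesco Thm. 2.1 for Nikulin involutions; cf. Thm.
2.9): on a projective K3 surface `S` with a Nikulin involution, real multiplication by `√2` on `T(S)` —
a rational, type-preserving `ψ` with `ψ² = 2` and `(ψx · ψy) = 2(x · y)` on `transcendentalSubspace S` —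
is induced by an algebraic cycle on `S × S`.**  Kernel, modulo the record (the dictionary lemma
`isNikulinInvolution_iff_isSymplecticOfPrimeOrder_two`). [cite: Varesco2023, Thm. 2.1 and Thm. 2.9 (p0010:L40–L45)]
[cite: VanGeemenSarti2007, §1.1] -/
theorem of_isNikulinInvolution (h : Varesco2023_sqrtMultiplication_algebraic_of_symplecticAutomorphism)
    {S : Motives.SchemeOver ℂ} (hS : IsK3Surface S) {ι : S ⟶ S} (hι : IsNikulinInvolution S ι)
    (ψ : complexBetti S (2 * 1) →ₗ[ℂ] complexBetti S (2 * 1))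
    (hT : Set.MapsTo ψ (transcendentalSubspace S) (transcendentalSubspace S))
    (hrat : ∀ x ∈ transcendentalSubspace S, IsRationalClass x → IsRationalClass (ψ x))
    (hH : ∀ (i j : ℕ), ∀ x ∈ transcendentalSubspace S,
      IsOfHodgeType 2 S (2 * 1) i j x → IsOfHodgeType 2 S (2 * 1) i j (ψ x))
    (hsq : ∀ x ∈ transcendentalSubspace S, ψ (ψ x) = (2 : ℂ) • x)
    (hmul : ∀ x ∈ transcendentalSubspace S, ∀ y ∈ transcendentalSubspace S,
      cupProduct (rfl : 2 * 1 + 2 * 1 = 2 * 2) (ψ x) (ψ y) =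
        (2 : ℂ) • cupProduct (rfl : 2 * 1 + 2 * 1 = 2 * 2) x y) :
    ∃ T : complexBetti S (2 * 1) →ₗ[ℂ] complexBetti S (2 * 1),
      IsAlgebraicCorrespondence 2 2 S S T ∧ ∀ x ∈ transcendentalSubspace S, T x = ψ x := by
  have key := h hS ι 2 (isNikulinInvolution_iff_isSymplecticOfPrimeOrder_two.1 hι) ψ hT hrat hH
  exact key (by exact_mod_cast hsq) (by exact_mod_cast hmul)

end Varesco2023_sqrtMultiplication_algebraic_of_symplecticAutomorphism

end Literature.AlgebraicGeometry.Surfaces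

end
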